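import Mathlib
import Summits.NavierStokesRegularity.NavierStokesRegularity.Theorems.EulerZoomLiouvillePowerGaugeEulerLiouvilleSwirlCapacityVelocityFloor
import HarnessLib

/-!
# Crux `EulerZoomLiouville.PowerGaugeEulerLiouville` (stmt-NavierStokesRegularity-19832), line `swirl-capacity`:
# POWER FLOORS — every typed lever of the line (log-sharp D2, square-log D2sq, power-lossy D2_pow) yields the power-lossy
# axis / swirl capacity floors `K_η γ₀² (V/A³)^η / A`

Route №10 `EulerZoomLiouville` (NavierStokesRegularity), crux E.  Line `swirl-capacity` (ideator ns-idea-11 g3;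
`Cruxes/PowerGaugeEulerLiouville/Lines/swirl_capacity.lean`, rev 2).  The line's endgame runs an exponent race
(`min(2, 1/(1−κ)) > 2 − ρ`, strict) that tolerates ANY sub-power loss `(V/A³)^η` in the capacity floor (`3η <` the gap), because in the
endgame the blob volume `V` is FIXED while `A = a/3 → ∞`.  This file (part 1 of the power-tolerant endgame, keyed by director-ns #185 (2))
records the floors in that currency:

`AxisPow_η : ∫_{B(3A)} ‖∇f‖²/r² ≥ K γ₀² (V/A³)^η / A`   (axisymmetric `C¹` scalar `f` vanishing on the axis, `f ≥ γ₀` on `T ⊆ B(0,A)`,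
`vol T ≥ V`),   `SwirlPow_η : ∫_{B(3A)} ‖∇v‖_F² ≥ K γ₀² (V/A³)^η / A`   (axisymmetric `C¹` field `v`, `|Γ| = |swirl v| ≥ γ₀` on `T`).

* `volume_le_six_mul_pow_three` — `T ⊆ B(0,A)`, `ofReal V ≤ vol T` ⇒ `V ≤ 6 A³` (`EuclideanSpace.volume_ball_fin_three`, `π ≤ 4`);
* `one_add_posLog_sq_le` — `(1 + log⁺ x)² ≤ (1 + 2/η)² 6^η x^η` for `x ≥ 1/6`, `η > 0` (`log x ≤ x^{η/2}/(η/2)`);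
* `floor_constant_bridge` — `K' γ₀² (V/A³)^η / A ≤ K γ₀² / (A (1 + log⁺(A³/V))²)` with `K' = K / ((1+2/η)² 6^η)`, `0 < V ≤ 6A³`;
* `axisCapacityFloorPow_of_axisCapacityFloorSq` — the rev-2 SQUARE-LOG axis floor (`AxisCapacityFloorSq`, unfolded) ⇒ `AxisPow_η` for all
  `η ∈ (0,1]`;  `axisCapacityFloorPow_of_axisCapacityFloor` — the log-sharp axis floor ⇒ the same (`1 + log⁺ ≤ (1 + log⁺)²`);
* `swirlCapacityFloorPowAt_of_axisCapacityFloorPowAt` — D2′ of the line (`swirlCapacityFloor_of_axisCapacityFloor`, file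
  `…SwirlCapacityVelocityFloor`) re-run at ONE exponent `η ∈ (0,1]`: `AxisPow_η` with constant `K` ⇒ `SwirlPow_η` with constant `K/8`
  (sign split `T = T⁺ ∪ T⁻`, one half carries `V/2`, `(1/2)^η ≥ 1/2`; `‖∇Γ‖² ≤ 4 r² ‖∇v‖_F²` by `norm_fderiv_swirl_sq_div_le`);
* `swirlCapacityFloorPow_of_axisCapacityFloorPow` — the same for all `η ∈ (0,1]` at once.

WHAT THIS IS NOT: not NS, not the crux — a helper `--supports` stmt-19832 on the line `swirl-capacity` (inequality bookkeeping for strata lemmas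
about a hypothetical class of ancient Euler solutions; the levers D2 / D2sq / D2_pow themselves are NOT proved here); no summit statement is
proved here. [cite: MajdaBertozziCUP2002, §2.3.3 (2.67) (the swirl); folklore (the inequalities)]
-/

noncomputable section

-- flat `Theorems/<Route><Decl>…` files of one crux share the namespace of the crux (tree convention)
set_option linter.dupNamespace false

open MeasureTheory Set Filter Topology Metric Function
open scoped NNReal ENNReal

namespace Summit.NavierStokesRegularity.NavierStokesRegularity.Theorems.PowerGaugeEulerLiouville.SwirlCapacity

open Literature.Analysis Literature.Analysis.FluidPDE

/-! ### Elementary bookkeeping: volumes in a ball, the logarithm against a power -/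

/-- A measurable set inside `B(0,A) ⊆ ℝ³` carrying volume `≥ V` forces `V ≤ 6 A³` (`vol B(0,A) = (4π/3) A³` and `π ≤ 4`). [folklore] -/
theorem volume_le_six_mul_pow_three {T : Set (EuclideanSpace ℝ (Fin 3))} {A V : ℝ} (hA : 0 < A)
    (hTA : T ⊆ ball (0 : EuclideanSpace ℝ (Fin 3)) A) (hvol : ENNReal.ofReal V ≤ volume T) : V ≤ 6 * A ^ 3 := by
  have h1 : volume T ≤ ENNReal.ofReal (6 * A ^ 3) := by
    refine (measure_mono hTA).trans ?_
    rw [EuclideanSpace.volume_ball_fin_three, ← ENNReal.ofReal_pow hA.le, ← ENNReal.ofReal_mul (pow_nonneg hA.le 3)]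
    refine ENNReal.ofReal_le_ofReal ?_
    have hπ : Real.pi ≤ 4 := Real.pi_le_four
    nlinarith [pow_pos hA 3]
  exact (ENNReal.ofReal_le_ofReal_iff (by positivity)).1 (hvol.trans h1)

/-- **The logarithm against a power, squared**: for `η > 0` and `x ≥ 1/6`,
`(1 + log⁺ x)² ≤ (1 + 2/η)² · 6^η · x^η` (`log x ≤ x^{η/2}/(η/2)` for `x ≥ 1`; `6x ≥ 1` below). [folklore] -/
theorem one_add_posLog_sq_le {η x : ℝ} (hη : 0 < η) (hx : 1 / 6 ≤ x) :
    (1 + max 0 (Real.log x)) ^ 2 ≤ (1 + 2 / η) ^ 2 * (6 : ℝ) ^ η * x ^ η := by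
  have hx0 : 0 < x := lt_of_lt_of_le (by norm_num) hx
  have h6 : (1 : ℝ) ≤ (6 : ℝ) ^ η := Real.one_le_rpow (by norm_num) hη.le
  have hc1 : (1 : ℝ) ≤ (1 + 2 / η) ^ 2 := by
    have : (1 : ℝ) ≤ 1 + 2 / η := by
      have := div_pos (two_pos) hη
      linarith
    nlinarith
  by_cases h1 : 1 ≤ x
  · -- `x ≥ 1`: `log x ≤ (2/η) x^{η/2}` and `1 ≤ x^{η/2}`
    have hlog0 : 0 ≤ Real.log x := Real.log_nonneg h1
    rw [max_eq_right hlog0]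
    have hh : 0 < η / 2 := by positivity
    have hlog : Real.log x ≤ x ^ (η / 2) / (η / 2) := Real.log_le_rpow_div hx0.le hh
    have hxη2 : 1 ≤ x ^ (η / 2) := Real.one_le_rpow h1 hh.le
    have hsum : 1 + Real.log x ≤ (1 + 2 / η) * x ^ (η / 2) := by
      have e : x ^ (η / 2) / (η / 2) = 2 / η * x ^ (η / 2) := by
        field_simp
      rw [e] at hlog
      nlinarith [div_pos two_pos hη]
    have hsq : (1 + Real.log x) ^ 2 ≤ ((1 + 2 / η) * x ^ (η / 2)) ^ 2 := by
      have h0 : 0 ≤ 1 + Real.log x := by linarith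
      nlinarith
    have hx2 : (x ^ (η / 2)) ^ 2 = x ^ η := by
      rw [← Real.rpow_natCast, ← Real.rpow_mul hx0.le]
      norm_num
    calc (1 + Real.log x) ^ 2 ≤ ((1 + 2 / η) * x ^ (η / 2)) ^ 2 := hsq
      _ = (1 + 2 / η) ^ 2 * 1 * x ^ η := by rw [mul_pow, hx2]; ring
      _ ≤ (1 + 2 / η) ^ 2 * (6 : ℝ) ^ η * x ^ η := by
          gcongr
  · -- `1/6 ≤ x < 1`: the left side is `1`, and `6^η x^η = (6x)^η ≥ 1`
    have hx1 : x < 1 := not_le.1 h1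
    have hlog : Real.log x ≤ 0 := Real.log_nonpos hx0.le hx1.le
    rw [max_eq_left hlog, add_zero, one_pow]
    have h6x : (1 : ℝ) ≤ (6 : ℝ) ^ η * x ^ η := by
      rw [← Real.mul_rpow (by norm_num) hx0.le]
      exact Real.one_le_rpow (by linarith) hη.le
    calc (1 : ℝ) = 1 * 1 := by ring
      _ ≤ (1 + 2 / η) ^ 2 * ((6 : ℝ) ^ η * x ^ η) := mul_le_mul hc1 h6x zero_le_one (by positivity)
      _ = (1 + 2 / η) ^ 2 * (6 : ℝ) ^ η * x ^ η := by ring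

/-- **Constant bookkeeping of the bridge**: with `K' = K / ((1+2/η)² 6^η)` and `0 < V ≤ 6A³`,
`K' γ₀² (V/A³)^η / A ≤ K γ₀² / (A (1 + log⁺(A³/V))²)` (in `ℝ≥0∞`). [folklore] -/
theorem floor_constant_bridge {η K A V γ₀ : ℝ} (hη : 0 < η) (hK : 0 < K) (hA : 0 < A) (hV : 0 < V) (hV6 : V ≤ 6 * A ^ 3) :
    ENNReal.ofReal (K / ((1 + 2 / η) ^ 2 * (6 : ℝ) ^ η) * γ₀ ^ 2 * (V / A ^ 3) ^ η / A) ≤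
      ENNReal.ofReal (K * γ₀ ^ 2 / (A * (1 + max 0 (Real.log (A ^ 3 / V))) ^ 2)) := by
  refine ENNReal.ofReal_le_ofReal ?_
  have hA3 : 0 < A ^ 3 := pow_pos hA 3
  set C : ℝ := (1 + 2 / η) ^ 2 * (6 : ℝ) ^ η with hC
  have hC0 : 0 < C := by positivity
  set x : ℝ := A ^ 3 / V with hx
  have hx0 : 0 < x := by positivity
  have hx6 : 1 / 6 ≤ x := by
    rw [hx, le_div_iff₀ hV]
    linarith
  set L : ℝ := 1 + max 0 (Real.log x) with hL
  have hL1 : 1 ≤ L := by rw [hL]; linarith [le_max_left 0 (Real.log x)]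
  have hbridge : L ^ 2 ≤ C * x ^ η := by rw [hL, hC]; exact one_add_posLog_sq_le hη hx6
  -- `(V/A³)^η · x^η = 1`
  have hinv : (V / A ^ 3) ^ η * x ^ η = 1 := by
    rw [← Real.mul_rpow (by positivity) hx0.le, hx, div_mul_div_comm, mul_comm V, div_self (by positivity), Real.one_rpow]
  have hyη : 0 < (V / A ^ 3) ^ η := Real.rpow_pos_of_pos (by positivity) _
  rw [div_le_div_iff₀ hA (by positivity)]
  -- goal: K/C γ₀² (V/A³)^η (A L²) ≤ K γ₀² A
  have key : (V / A ^ 3) ^ η * L ^ 2 ≤ C := by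
    calc (V / A ^ 3) ^ η * L ^ 2 ≤ (V / A ^ 3) ^ η * (C * x ^ η) := mul_le_mul_of_nonneg_left hbridge hyη.le
      _ = C * ((V / A ^ 3) ^ η * x ^ η) := by ring
      _ = C := by rw [hinv, mul_one]
  have hγ : 0 ≤ γ₀ ^ 2 := sq_nonneg _
  calc K / C * γ₀ ^ 2 * (V / A ^ 3) ^ η * (A * L ^ 2) = K / C * (γ₀ ^ 2 * A) * ((V / A ^ 3) ^ η * L ^ 2) := by ring
    _ ≤ K / C * (γ₀ ^ 2 * A) * C := mul_le_mul_of_nonneg_left key (by positivity)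
    _ = K * γ₀ ^ 2 * A := by field_simp

/-! ### The bridges: square-log / log-sharp axis floors give the power axis floors -/

/-- **Square-log ⇒ power (axis form)**: the rev-2 square-log axis capacity floor (`AxisCapacityFloorSq`, unfolded) gives, for every
`η ∈ (0,1]`, the power-lossy axis floor `∫_{B(3A)} ‖∇f‖²/r² ≥ K_η γ₀² (V/A³)^η / A`. [folklore] -/
theorem axisCapacityFloorPow_of_axisCapacityFloorSq
    (hsq : ∃ K : ℝ, 0 < K ∧ ∀ (f : EuclideanSpace ℝ (Fin 3) → ℝ) (T : Set (EuclideanSpace ℝ (Fin 3))) (A V γ₀ : ℝ),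
      ContDiff ℝ 1 f → IsAxisymmetricScalar f →
      (∀ x : EuclideanSpace ℝ (Fin 3), cylRadius x = 0 → f x = 0) → 0 < A → 0 < V → 0 < γ₀ → MeasurableSet T →
      T ⊆ ball (0 : EuclideanSpace ℝ (Fin 3)) A →
      ENNReal.ofReal V ≤ volume T → (∀ x ∈ T, γ₀ ≤ f x) →
        ENNReal.ofReal (K * γ₀ ^ 2 / (A * (1 + max 0 (Real.log (A ^ 3 / V))) ^ 2)) ≤
          ∫⁻ x in ball (0 : EuclideanSpace ℝ (Fin 3)) (3 * A), ENNReal.ofReal (‖fderiv ℝ f x‖ ^ 2 / cylRadius x ^ 2)) :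
    ∀ η : ℝ, 0 < η → η ≤ 1 → ∃ K : ℝ, 0 < K ∧
      ∀ (f : EuclideanSpace ℝ (Fin 3) → ℝ) (T : Set (EuclideanSpace ℝ (Fin 3))) (A V γ₀ : ℝ),
      ContDiff ℝ 1 f → IsAxisymmetricScalar f →
      (∀ x : EuclideanSpace ℝ (Fin 3), cylRadius x = 0 → f x = 0) → 0 < A → 0 < V → 0 < γ₀ → MeasurableSet T →
      T ⊆ ball (0 : EuclideanSpace ℝ (Fin 3)) A →
      ENNReal.ofReal V ≤ volume T → (∀ x ∈ T, γ₀ ≤ f x) →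
        ENNReal.ofReal (K * γ₀ ^ 2 * (V / A ^ 3) ^ η / A) ≤
          ∫⁻ x in ball (0 : EuclideanSpace ℝ (Fin 3)) (3 * A), ENNReal.ofReal (‖fderiv ℝ f x‖ ^ 2 / cylRadius x ^ 2) := by
  intro η hη _
  obtain ⟨K, hK, hfloor⟩ := hsq
  refine ⟨K / ((1 + 2 / η) ^ 2 * (6 : ℝ) ^ η), by positivity, ?_⟩
  intro f T A V γ₀ hf hax h0 hA hV hγ hT hTA hvol hlev
  exact (floor_constant_bridge hη hK hA hV (volume_le_six_mul_pow_three hA hTA hvol)).trans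
    (hfloor f T A V γ₀ hf hax h0 hA hV hγ hT hTA hvol hlev)

/-- **Log-sharp ⇒ power (axis form)**: the log-sharp axis capacity floor (`AxisCapacityFloor`, unfolded) gives the power-lossy axis
floors for every `η ∈ (0,1]` (through the square-log floor: `1 + log⁺ ≤ (1 + log⁺)²`). [folklore] -/
theorem axisCapacityFloorPow_of_axisCapacityFloor
    (hlog : ∃ K : ℝ, 0 < K ∧ ∀ (f : EuclideanSpace ℝ (Fin 3) → ℝ) (T : Set (EuclideanSpace ℝ (Fin 3))) (A V γ₀ : ℝ),
      ContDiff ℝ 1 f → IsAxisymmetricScalar f →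
      (∀ x : EuclideanSpace ℝ (Fin 3), cylRadius x = 0 → f x = 0) → 0 < A → 0 < V → 0 < γ₀ → MeasurableSet T →
      T ⊆ ball (0 : EuclideanSpace ℝ (Fin 3)) A →
      ENNReal.ofReal V ≤ volume T → (∀ x ∈ T, γ₀ ≤ f x) →
        ENNReal.ofReal (K * γ₀ ^ 2 / (A * (1 + max 0 (Real.log (A ^ 3 / V))))) ≤
          ∫⁻ x in ball (0 : EuclideanSpace ℝ (Fin 3)) (3 * A), ENNReal.ofReal (‖fderiv ℝ f x‖ ^ 2 / cylRadius x ^ 2)) :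
    ∀ η : ℝ, 0 < η → η ≤ 1 → ∃ K : ℝ, 0 < K ∧
      ∀ (f : EuclideanSpace ℝ (Fin 3) → ℝ) (T : Set (EuclideanSpace ℝ (Fin 3))) (A V γ₀ : ℝ),
      ContDiff ℝ 1 f → IsAxisymmetricScalar f →
      (∀ x : EuclideanSpace ℝ (Fin 3), cylRadius x = 0 → f x = 0) → 0 < A → 0 < V → 0 < γ₀ → MeasurableSet T →
      T ⊆ ball (0 : EuclideanSpace ℝ (Fin 3)) A →
      ENNReal.ofReal V ≤ volume T → (∀ x ∈ T, γ₀ ≤ f x) →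
        ENNReal.ofReal (K * γ₀ ^ 2 * (V / A ^ 3) ^ η / A) ≤
          ∫⁻ x in ball (0 : EuclideanSpace ℝ (Fin 3)) (3 * A), ENNReal.ofReal (‖fderiv ℝ f x‖ ^ 2 / cylRadius x ^ 2) := by
  refine axisCapacityFloorPow_of_axisCapacityFloorSq ?_
  obtain ⟨K, hK, hfloor⟩ := hlog
  refine ⟨K, hK, ?_⟩
  intro f T A V γ₀ hf hax h0 hA hV hγ hT hTA hvol hlev
  refine le_trans (ENNReal.ofReal_le_ofReal ?_) (hfloor f T A V γ₀ hf hax h0 hA hV hγ hT hTA hvol hlev)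
  have hL : 1 ≤ 1 + max 0 (Real.log (A ^ 3 / V)) := by linarith [le_max_left 0 (Real.log (A ^ 3 / V))]
  refine div_le_div_of_nonneg_left (by positivity) (by positivity) ?_
  refine mul_le_mul_of_nonneg_left ?_ hA.le
  nlinarith

/-! ### D2′ re-run: axis power floors give swirl power floors -/

/-- **The velocity form of a power floor, one exponent** (D2′ of the line re-run verbatim with `(V/A³)^η` in place of
`1/(1+log⁺(A³/V))`): the axis power floor at exponent `η ∈ (0,1]` with constant `K`, applied to `f = ±Γ = ±swirl v` on the half of `T`
carrying volume `≥ V/2` (sign split; `(1/2)^η ≥ 1/2`), and `‖∇Γ‖² ≤ 4 r² ‖∇v‖_F²` (`norm_fderiv_swirl_sq_div_le`) give the swirl power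
floor at the same exponent with constant `K/8`. [cite: MajdaBertozziCUP2002, §2.3.3 (2.67)] -/
theorem swirlCapacityFloorPowAt_of_axisCapacityFloorPowAt {η K : ℝ} (hη1 : η ≤ 1) (hK : 0 < K)
    (hfloor : ∀ (f : EuclideanSpace ℝ (Fin 3) → ℝ) (T : Set (EuclideanSpace ℝ (Fin 3))) (A V γ₀ : ℝ),
      ContDiff ℝ 1 f → IsAxisymmetricScalar f →
      (∀ x : EuclideanSpace ℝ (Fin 3), cylRadius x = 0 → f x = 0) → 0 < A → 0 < V → 0 < γ₀ → MeasurableSet T →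
      T ⊆ ball (0 : EuclideanSpace ℝ (Fin 3)) A →
      ENNReal.ofReal V ≤ volume T → (∀ x ∈ T, γ₀ ≤ f x) →
        ENNReal.ofReal (K * γ₀ ^ 2 * (V / A ^ 3) ^ η / A) ≤
          ∫⁻ x in ball (0 : EuclideanSpace ℝ (Fin 3)) (3 * A), ENNReal.ofReal (‖fderiv ℝ f x‖ ^ 2 / cylRadius x ^ 2))
    (v : EuclideanSpace ℝ (Fin 3) → EuclideanSpace ℝ (Fin 3)) (T : Set (EuclideanSpace ℝ (Fin 3))) (A V γ₀ : ℝ)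
    (hv1 : ContDiff ℝ 1 v) (hax : IsAxisymmetric v) (hA : 0 < A) (hV : 0 < V) (hγ : 0 < γ₀) (hT : MeasurableSet T)
    (hTA : T ⊆ ball (0 : EuclideanSpace ℝ (Fin 3)) A) (hvol : ENNReal.ofReal V ≤ volume T)
    (hlevel : ∀ x ∈ T, γ₀ ≤ |swirl v x|) :
    ENNReal.ofReal (K / 8 * γ₀ ^ 2 * (V / A ^ 3) ^ η / A) ≤
      ∫⁻ x in ball (0 : EuclideanSpace ℝ (Fin 3)) (3 * A), ENNReal.ofReal (frobeniusNormSq (fderiv ℝ v x)) := by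
  -- adapted from `swirlCapacityFloor_of_axisCapacityFloor` (…SwirlCapacityVelocityFloor, ns-ezl-w3)
  have hvd : Differentiable ℝ v := hv1.differentiable one_ne_zero
  have hA3 : 0 < A ^ 3 := pow_pos hA 3
  -- GENERIC HALF-STEP: the floor for `f = ±Γ` on a half `T' ⊆ T` of volume `≥ V/2` gives the swirl floor
  have key : ∀ (f : EuclideanSpace ℝ (Fin 3) → ℝ) (T' : Set (EuclideanSpace ℝ (Fin 3))),
      ContDiff ℝ 1 f → IsAxisymmetricScalar f → (∀ x, cylRadius x = 0 → f x = 0) →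
      (∀ x, ‖fderiv ℝ f x‖ = ‖fderiv ℝ (swirl v) x‖) → MeasurableSet T' → T' ⊆ T →
      ENNReal.ofReal (V / 2) ≤ volume T' → (∀ x ∈ T', γ₀ ≤ f x) →
      ENNReal.ofReal (K / 8 * γ₀ ^ 2 * (V / A ^ 3) ^ η / A) ≤
        ∫⁻ x in ball (0 : EuclideanSpace ℝ (Fin 3)) (3 * A), ENNReal.ofReal (frobeniusNormSq (fderiv ℝ v x)) := by
    intro f T' hf hfax hf0 hnorm hT' hT'T hvol' hlev'
    have hfl := hfloor f T' A (V / 2) γ₀ hf hfax hf0 hA (by positivity) hγ hT' (hT'T.trans hTA) hvol' hlev'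
    -- compare the integrands pointwise
    have hint : ∫⁻ x in ball (0 : EuclideanSpace ℝ (Fin 3)) (3 * A), ENNReal.ofReal (‖fderiv ℝ f x‖ ^ 2 / cylRadius x ^ 2) ≤
        ENNReal.ofReal 4 * ∫⁻ x in ball (0 : EuclideanSpace ℝ (Fin 3)) (3 * A),
          ENNReal.ofReal (frobeniusNormSq (fderiv ℝ v x)) := by
      rw [← lintegral_const_mul' _ _ ENNReal.ofReal_ne_top]
      refine lintegral_mono fun x => ?_
      rw [← ENNReal.ofReal_mul (by norm_num)]
      refine ENNReal.ofReal_le_ofReal ?_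
      rw [hnorm x]
      exact norm_fderiv_swirl_sq_div_le hax (hvd x)
    -- the constants: `((V/2)/A³)^η = (1/2)^η (V/A³)^η ≥ (1/2) (V/A³)^η` for `η ≤ 1`
    have hy0 : 0 ≤ V / A ^ 3 := by positivity
    have hhalf : (1 / 2 : ℝ) * (V / A ^ 3) ^ η ≤ (V / 2 / A ^ 3) ^ η := by
      have e : V / 2 / A ^ 3 = (1 / 2) * (V / A ^ 3) := by ring
      rw [e, Real.mul_rpow (by norm_num) hy0]
      refine mul_le_mul_of_nonneg_right ?_ (Real.rpow_nonneg hy0 _)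
      -- `(1/2)^η ≥ (1/2)^1 = 1/2` since `η ≤ 1` and `1/2 ≤ 1`
      calc (1 / 2 : ℝ) = (1 / 2 : ℝ) ^ (1 : ℝ) := (Real.rpow_one _).symm
        _ ≤ (1 / 2 : ℝ) ^ η := Real.rpow_le_rpow_of_exponent_ge (by norm_num) (by norm_num) hη1
    have hreal : 4 * (K / 8 * γ₀ ^ 2 * (V / A ^ 3) ^ η / A) ≤ K * γ₀ ^ 2 * (V / 2 / A ^ 3) ^ η / A := by
      rw [show 4 * (K / 8 * γ₀ ^ 2 * (V / A ^ 3) ^ η / A) = K * γ₀ ^ 2 * ((1 / 2) * (V / A ^ 3) ^ η) / A by ring]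
      refine div_le_div_of_nonneg_right ?_ hA.le
      exact mul_le_mul_of_nonneg_left hhalf (by positivity)
    -- assemble in `ℝ≥0∞` and cancel the factor `4`
    have h4 : ENNReal.ofReal 4 ≠ 0 := (ENNReal.ofReal_pos.2 (by norm_num)).ne'
    have hchain : ENNReal.ofReal 4 * ENNReal.ofReal (K / 8 * γ₀ ^ 2 * (V / A ^ 3) ^ η / A) ≤
        ENNReal.ofReal 4 * ∫⁻ x in ball (0 : EuclideanSpace ℝ (Fin 3)) (3 * A),
          ENNReal.ofReal (frobeniusNormSq (fderiv ℝ v x)) :=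
      calc ENNReal.ofReal 4 * ENNReal.ofReal (K / 8 * γ₀ ^ 2 * (V / A ^ 3) ^ η / A)
          = ENNReal.ofReal (4 * (K / 8 * γ₀ ^ 2 * (V / A ^ 3) ^ η / A)) := (ENNReal.ofReal_mul (by norm_num)).symm
        _ ≤ ENNReal.ofReal (K * γ₀ ^ 2 * (V / 2 / A ^ 3) ^ η / A) := ENNReal.ofReal_le_ofReal hreal
        _ ≤ _ := hfl
        _ ≤ _ := hint
    exact (ENNReal.mul_le_mul_iff_right h4 ENNReal.ofReal_ne_top).1 hchain
  -- THE SIGN SPLIT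
  have hcont : Continuous (swirl v) := (contDiff_swirl hv1).continuous
  have hmeasP : MeasurableSet (T ∩ {x | γ₀ ≤ swirl v x}) :=
    hT.inter (measurableSet_le measurable_const hcont.measurable)
  have hmeasM : MeasurableSet (T ∩ {x | γ₀ ≤ -swirl v x}) :=
    hT.inter (measurableSet_le measurable_const hcont.neg.measurable)
  have hcover : T ⊆ (T ∩ {x | γ₀ ≤ swirl v x}) ∪ (T ∩ {x | γ₀ ≤ -swirl v x}) := by
    intro x hx
    rcases le_abs.1 (hlevel x hx) with h | h
    · exact Or.inl ⟨hx, h⟩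
    · exact Or.inr ⟨hx, h⟩
  have hhalf : ENNReal.ofReal (V / 2) ≤ volume (T ∩ {x | γ₀ ≤ swirl v x}) ∨
      ENNReal.ofReal (V / 2) ≤ volume (T ∩ {x | γ₀ ≤ -swirl v x}) := by
    by_contra hcon
    simp only [not_or, not_le] at hcon
    have h1 : volume T ≤ volume (T ∩ {x | γ₀ ≤ swirl v x}) + volume (T ∩ {x | γ₀ ≤ -swirl v x}) :=
      (measure_mono hcover).trans (measure_union_le _ _)
    have h2 : volume (T ∩ {x | γ₀ ≤ swirl v x}) + volume (T ∩ {x | γ₀ ≤ -swirl v x}) <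
        ENNReal.ofReal (V / 2) + ENNReal.ofReal (V / 2) := ENNReal.add_lt_add hcon.1 hcon.2
    rw [← ENNReal.ofReal_add (by positivity) (by positivity), add_halves] at h2
    exact absurd (hvol.trans h1) (not_le.2 h2)
  rcases hhalf with hP | hM
  · -- the positive half: `f = Γ`
    exact key (swirl v) _ (contDiff_swirl hv1) hax.isAxisymmetricScalar_swirl
      (fun x hx => swirl_eq_zero_of_cylRadius_eq_zero v hx) (fun x => rfl) hmeasP inter_subset_left hP
      (fun x hx => hx.2)
  · -- the negative half: `f = -Γ`
    refine key (fun x => -swirl v x) _ (contDiff_swirl hv1).neg (fun θ x => ?_)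
      (fun x hx => by rw [swirl_eq_zero_of_cylRadius_eq_zero v hx, neg_zero]) (fun x => ?_) hmeasM
      inter_subset_left hM (fun x hx => hx.2)
    · simp only [hax.swirl_rotZ θ x]
    · rw [fderiv_fun_neg, norm_neg]

/-- **The velocity form of the power floors** (all exponents `η ∈ (0,1]` at once). [cite: MajdaBertozziCUP2002, §2.3.3 (2.67)] -/
theorem swirlCapacityFloorPow_of_axisCapacityFloorPow
    (hax : ∀ η : ℝ, 0 < η → η ≤ 1 → ∃ K : ℝ, 0 < K ∧
      ∀ (f : EuclideanSpace ℝ (Fin 3) → ℝ) (T : Set (EuclideanSpace ℝ (Fin 3))) (A V γ₀ : ℝ),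
      ContDiff ℝ 1 f → IsAxisymmetricScalar f →
      (∀ x : EuclideanSpace ℝ (Fin 3), cylRadius x = 0 → f x = 0) → 0 < A → 0 < V → 0 < γ₀ → MeasurableSet T →
      T ⊆ ball (0 : EuclideanSpace ℝ (Fin 3)) A →
      ENNReal.ofReal V ≤ volume T → (∀ x ∈ T, γ₀ ≤ f x) →
        ENNReal.ofReal (K * γ₀ ^ 2 * (V / A ^ 3) ^ η / A) ≤
          ∫⁻ x in ball (0 : EuclideanSpace ℝ (Fin 3)) (3 * A), ENNReal.ofReal (‖fderiv ℝ f x‖ ^ 2 / cylRadius x ^ 2)) :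
    ∀ η : ℝ, 0 < η → η ≤ 1 → ∃ K : ℝ, 0 < K ∧
      ∀ (v : EuclideanSpace ℝ (Fin 3) → EuclideanSpace ℝ (Fin 3)) (T : Set (EuclideanSpace ℝ (Fin 3))) (A V γ₀ : ℝ),
      ContDiff ℝ 1 v → IsAxisymmetric v →
      0 < A → 0 < V → 0 < γ₀ → MeasurableSet T → T ⊆ ball (0 : EuclideanSpace ℝ (Fin 3)) A →
      ENNReal.ofReal V ≤ volume T → (∀ x ∈ T, γ₀ ≤ |swirl v x|) →
        ENNReal.ofReal (K * γ₀ ^ 2 * (V / A ^ 3) ^ η / A) ≤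
          ∫⁻ x in ball (0 : EuclideanSpace ℝ (Fin 3)) (3 * A), ENNReal.ofReal (frobeniusNormSq (fderiv ℝ v x)) := by
  intro η hη hη1
  obtain ⟨K, hK, hfloor⟩ := hax η hη hη1
  exact ⟨K / 8, by positivity, swirlCapacityFloorPowAt_of_axisCapacityFloorPowAt hη1 hK hfloor⟩

end Summit.NavierStokesRegularity.NavierStokesRegularity.Theorems.PowerGaugeEulerLiouville.SwirlCapacity

end
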